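import Mathlib
import HarnessLib
import Summits.Ventures.LatticeQCDFlow.Scoring.MarkovChainCLTStudentized
import Summits.Ventures.LatticeQCDFlow.Scoring.IndepMHRetrospectiveCoins

/-!
# The independence Metropolis sampler WITH ITS RETROSPECTIVE REGENERATION COINS — an implementable
# procedure — reports an asymptotically exact error bar for its own time averages

HONEST FRAMING: exact (Metropolis-corrected) sampling algorithms for lattice gauge theory;
figures of merit are autocorrelation/cost numbers at stated couplings and volumes; no
continuum-physics claim.

`Scoring/IndepMHRetrospectiveCoins.lean` showed that for the independence Metropolis kernel
`K = indepMH q (1/ρ)` (`q = ρ·π`, `ρ > 0` measurable, `ρ x ≤ e^M ρ y`) the coin-augmented step —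
propose `y ∼ q`, accept with probability `min(1, ρ x / ρ y)`, on acceptance flip heads with
probability `e^{−M} max(1/ρ x, 1/ρ y)`, on rejection record tails — has EXACTLY the law of the split
kernel of `(K, π, e^{−M})`.  `Scoring/MarkovChainCLTStudentized.lean` showed that along any split
chain the studentised time average `√n (f̄_n − π f) / σ̂_n`, with `σ̂²_n = V̂_{R_n} / N̄_{R_n}` the
tour estimator built from the `R_n = K_{n−1} − 1` completed tours, converges in distribution to
`N(0, 1)` when `σ²_f > 0`.  This file puts the two together: for ANY Markov kernel `κs` on
`Ω × Bool` whose one-step laws are the coin-augmented Metropolis laws (such a kernel exists,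
`exists_indepMH_retroKernel`) and ANY initial law, the procedure's own interval
`f̄_n ± z σ̂_n / √n` covers `π f` with probability tending to `(gaussianReal 0 1)[−z, z]`, and
`σ̂²_n → σ²_f` almost surely.

* `indepMH_retro_sigmaHat_strongLaw` — `σ̂²_n → σ²_f(K)` a.s. along the coin-augmented sampler;
* `indepMH_retro_studentized_coverage` — `P(|√n (f̄_n − πf)| ≤ z σ̂_n) → (gaussianReal 0 1)[−z, z]`.

NOT CLAIMED: any `M` for a concrete proposal (for the SU(n)^E flow sampler `M` comes from the
density bounds, `Exactness/`); a rate; the case `σ²_f = 0`; unbounded observables.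
-/

noncomputable section

namespace Summit.Ventures.LatticeQCDFlow.Scoring

open MeasureTheory ProbabilityTheory Filter Finset Summit.Ventures.LatticeQCDFlow.Exactness
open Literature.Probability.MarkovChains
open scoped ENNReal Topology

variable {Ω : Type*} [MeasurableSpace Ω]

section RetroStudentized

variable {π q : Measure Ω} [IsProbabilityMeasure π] [IsProbabilityMeasure q] {ρ : Ω → ℝ} {M : ℝ}

/-- **THE COIN-AUGMENTED IMH SAMPLER'S VARIANCE ESTIMATE IS STRONGLY CONSISTENT**: along the run of
any Markov kernel realising the coin-augmented Metropolis step, from any initial law,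
`σ̂²_n → σ²_f(indepMH q (1/ρ))` almost surely. -/
theorem indepMH_retro_sigmaHat_strongLaw (hρm : Measurable ρ) (hρ0 : ∀ x, 0 < ρ x)
    (hq : q = π.withDensity fun x => ENNReal.ofReal (ρ x)) (hM0 : 0 < M)
    (hM : ∀ x y, ρ x ≤ Real.exp M * ρ y)
    (κs : Kernel (Ω × Bool) (Ω × Bool)) [IsMarkovKernel κs]
    (hκs : haveI : Fact (Measurable fun z => (ρ z)⁻¹) := ⟨hρm.inv⟩
      (∀ p, κs p = (q.withDensity (fun y => imhAcceptE (fun z => (ρ z)⁻¹) p.1 y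
          * ENNReal.ofReal (Real.exp (-M) * max (ρ p.1)⁻¹ (ρ y)⁻¹))).map (fun y : Ω => (y, true))
        + ((q.withDensity (fun y => imhAcceptE (fun z => (ρ z)⁻¹) p.1 y
            * (1 - ENNReal.ofReal (Real.exp (-M) * max (ρ p.1)⁻¹ (ρ y)⁻¹))))
          + (1 - imhAcceptMass q (fun z => (ρ z)⁻¹) p.1) • Measure.dirac p.1).map
            (fun y : Ω => (y, false))))
    (μs : Measure (Ω × Bool)) [IsProbabilityMeasure μs]
    {f : Ω → ℝ} (hf : Measurable f) {C : ℝ} (hC : ∀ x, |f x| ≤ C) :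
    haveI : Fact (Measurable fun z => (ρ z)⁻¹) := ⟨hρm.inv⟩
    ∀ᵐ x ∂(Kernel.trajMeasure (X := fun _ : ℕ => Ω × Bool) μs
        (fun m : ℕ => κs.comap (fun h : (i : ↥(Finset.Iic m)) → Ω × Bool =>
          h ⟨m, Finset.mem_Iic.2 le_rfl⟩) (measurable_pi_apply _))),
      Tendsto (fun n : ℕ => (((∑ i ∈ Finset.range (((∑ s ∈ Finset.range (n - 1), (if (x (s + 1)).2 then (1 : ℕ) else 0)) - 1 : ℕ)), ((∑' u, (if (∑ s ∈ Finset.range u, (if (x (s + 1)).2 then (1 : ℕ) else 0)) = i + 1 then (1 : ℝ) else 0) * f (x u).1) - ((∑ i ∈ Finset.range (((∑ s ∈ Finset.range (n - 1), (if (x (s + 1)).2 then (1 : ℕ) else 0)) - 1 : ℕ)), (∑' u, (if (∑ s ∈ Finset.range u, (if (x (s + 1)).2 then (1 : ℕ) else 0)) = i + 1 then (1 : ℝ) else 0) * f (x u).1)) / (∑ i ∈ Finset.range (((∑ s ∈ Finset.range (n - 1), (if (x (s + 1)).2 then (1 : ℕ) else 0)) - 1 : ℕ)), (∑' u, (if (∑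 s ∈ Finset.range u, (if (x (s + 1)).2 then (1 : ℕ) else 0)) = i + 1 then (1 : ℝ) else 0)))) * (∑' u, (if (∑ s ∈ Finset.range u, (if (x (s + 1)).2 then (1 : ℕ) else 0)) = i + 1 then (1 : ℝ) else 0))) ^ 2) / (((∑ s ∈ Finset.range (n - 1), (if (x (s + 1)).2 then (1 : ℕ) else 0)) - 1 : ℕ))) / ((∑ i ∈ Finset.range (((∑ s ∈ Finset.range (n - 1), (if (x (s + 1)).2 then (1 : ℕ) else 0)) - 1 : ℕ)), (∑' u, (if (∑ s ∈ Finset.range u, (if (x (s + 1)).2 then (1 : ℕ) else 0)) = i + 1 then (1 : ℝ) else 0))) / (((∑ s ∈ Finset.range (n - 1), (if (x (s + 1)).2 then (1 : ℕ) else 0)) - 1 : ℕ))))) atTop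
        (𝓝 ((∫ y, (f y - ∫ z, f z ∂π) ^ 2 ∂π)
        + 2 * ∑' k, ∫ y, (f y - ∫ z, f z ∂π)
          * (kop (indepMH q fun x => (ρ x)⁻¹))^[k + 1] (fun y => f y - ∫ z, f z ∂π) y ∂π)) := by
  haveI : Fact (Measurable fun z => (ρ z)⁻¹) := ⟨hρm.inv⟩
  obtain ⟨hinv, -, -⟩ := indepMH_exact_doeblin_of_density_ratio hρm hρ0 hq hM
  have hε0 : 0 < ENNReal.ofReal (Real.exp (-M)) := ENNReal.ofReal_pos.2 (Real.exp_pos _)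
  have hε1 : ENNReal.ofReal (Real.exp (-M)) < 1 := by
    rw [ENNReal.ofReal_lt_one]
    exact Real.exp_lt_one_iff.2 (by linarith)
  have hκs' := fun p => (hκs p).trans (indepMH_retro_eq_split hρm hρ0 hq hM0 hM p.1)
  exact splitChain_sigmaHat_strongLaw κs μs (κ := indepMH q fun z => (ρ z)⁻¹) (ν := π) hinv hε0
    hε1 hκs' hf hC

/-- **THE IMPLEMENTABLE SAMPLER'S OWN ERROR BAR IS ASYMPTOTICALLY EXACT.**  `κs` any Markov kernel
realising the coin-augmented independence Metropolis step (`exists_indepMH_retroKernel`), any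
initial law, `|f| ≤ C` measurable with `σ²_f > 0`, `z > 0`:
`P(|(√n)⁻¹ Σ_{t<n} (f(x_t) − π f)| ≤ z σ̂_n) → (gaussianReal 0 1)[−z, z]`. -/
theorem indepMH_retro_studentized_coverage (hρm : Measurable ρ) (hρ0 : ∀ x, 0 < ρ x)
    (hq : q = π.withDensity fun x => ENNReal.ofReal (ρ x)) (hM0 : 0 < M)
    (hM : ∀ x y, ρ x ≤ Real.exp M * ρ y)
    (κs : Kernel (Ω × Bool) (Ω × Bool)) [IsMarkovKernel κs]
    (hκs : haveI : Fact (Measurable fun z => (ρ z)⁻¹) := ⟨hρm.inv⟩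
      (∀ p, κs p = (q.withDensity (fun y => imhAcceptE (fun z => (ρ z)⁻¹) p.1 y
          * ENNReal.ofReal (Real.exp (-M) * max (ρ p.1)⁻¹ (ρ y)⁻¹))).map (fun y : Ω => (y, true))
        + ((q.withDensity (fun y => imhAcceptE (fun z => (ρ z)⁻¹) p.1 y
            * (1 - ENNReal.ofReal (Real.exp (-M) * max (ρ p.1)⁻¹ (ρ y)⁻¹))))
          + (1 - imhAcceptMass q (fun z => (ρ z)⁻¹) p.1) • Measure.dirac p.1).map
            (fun y : Ω => (y, false))))
    (μs : Measure (Ω × Bool)) [IsProbabilityMeasure μs]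
    {f : Ω → ℝ} (hf : Measurable f) {C : ℝ} (hC : ∀ x, |f x| ≤ C)
    (hσ : haveI : Fact (Measurable fun z => (ρ z)⁻¹) := ⟨hρm.inv⟩
      0 < ((∫ y, (f y - ∫ z, f z ∂π) ^ 2 ∂π)
        + 2 * ∑' k, ∫ y, (f y - ∫ z, f z ∂π)
          * (kop (indepMH q fun x => (ρ x)⁻¹))^[k + 1] (fun y => f y - ∫ z, f z ∂π) y ∂π))
    {z : ℝ} (hz : 0 < z) :
    Tendsto (fun n : ℕ => (Kernel.trajMeasure (X := fun _ : ℕ => Ω × Bool) μs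
        (fun m : ℕ => κs.comap (fun h : (i : ↥(Finset.Iic m)) → Ω × Bool =>
          h ⟨m, Finset.mem_Iic.2 le_rfl⟩) (measurable_pi_apply _))).real
      {x | |((Real.sqrt n)⁻¹ * ∑ t ∈ Finset.range n, (f (x t).1 - ∫ z, f z ∂π)) / Real.sqrt (((∑ i ∈ Finset.range (((∑ s ∈ Finset.range (n - 1), (if (x (s + 1)).2 then (1 : ℕ) else 0)) - 1 : ℕ)), ((∑' u, (if (∑ s ∈ Finset.range u, (if (x (s + 1)).2 then (1 : ℕ) else 0)) = i + 1 then (1 : ℝ) else 0) * f (x u).1) - ((∑ i ∈ Finset.range (((∑ s ∈ Finset.range (n - 1), (if (x (s + 1)).2 then (1 : ℕ) else 0)) - 1 : ℕ)), (∑' u, (if (∑ s ∈ Finset.range u, (if (x (s + 1)).2 then (1 : ℕ) else 0)) = i + 1 then (1 : ℝ) else 0) * f (x u).1)) / (∑ i ∈ Finset.range (((∑ s ∈ Finset.range (n - 1), (if (x (s + 1)).2 then (1 : ℕ) else 0)) - 1 : ℕ)), (∑' u, (if (∑ s ∈ Finset.range u, (if (x (s + 1)).2 then (1 : ℕ) else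 0)) = i + 1 then (1 : ℝ) else 0)))) * (∑' u, (if (∑ s ∈ Finset.range u, (if (x (s + 1)).2 then (1 : ℕ) else 0)) = i + 1 then (1 : ℝ) else 0))) ^ 2) / (((∑ s ∈ Finset.range (n - 1), (if (x (s + 1)).2 then (1 : ℕ) else 0)) - 1 : ℕ))) / ((∑ i ∈ Finset.range (((∑ s ∈ Finset.range (n - 1), (if (x (s + 1)).2 then (1 : ℕ) else 0)) - 1 : ℕ)), (∑' u, (if (∑ s ∈ Finset.range u, (if (x (s + 1)).2 then (1 : ℕ) else 0)) = i + 1 then (1 : ℝ) else 0))) / (((∑ s ∈ Finset.range (n - 1), (if (x (s + 1)).2 then (1 : ℕ) else 0)) - 1 : ℕ))))| ≤ z})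
      atTop (𝓝 ((gaussianReal 0 1).real (Set.Icc (-z) z))) := by
  haveI : Fact (Measurable fun z => (ρ z)⁻¹) := ⟨hρm.inv⟩
  obtain ⟨hinv, -, -⟩ := indepMH_exact_doeblin_of_density_ratio hρm hρ0 hq hM
  have hε0 : 0 < ENNReal.ofReal (Real.exp (-M)) := ENNReal.ofReal_pos.2 (Real.exp_pos _)
  have hε1 : ENNReal.ofReal (Real.exp (-M)) < 1 := by
    rw [ENNReal.ofReal_lt_one]
    exact Real.exp_lt_one_iff.2 (by linarith)
  have hκs' := fun p => (hκs p).trans (indepMH_retro_eq_split hρm hρ0 hq hM0 hM p.1)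
  exact splitChain_timeAverage_studentized_coverage κs μs (κ := indepMH q fun z => (ρ z)⁻¹) (ν := π)
    hinv hε0 hε1 hκs' hf hC hσ hz

end RetroStudentized

end Summit.Ventures.LatticeQCDFlow.Scoring

end
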